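import Summits.ResolutionOfSingularities.ResolutionOfSingularities.Theorems.PurelyInseparableDim4ChartAtlasInsideAlgebra
import Summits.ResolutionOfSingularities.ResolutionOfSingularities.Theorems.PurelyInseparableDim4ChartAtlasCover
import Summits.ResolutionOfSingularities.ResolutionOfSingularities.Theorems.PurelyInseparableDim4ChartClosureInside
import Literature.AlgebraicGeometry.Resolution.NormalCrossingsLocal
import HarnessLib

/-!
# Purely inseparable four-folds `z^p + F(x₁, …, x₄)`: the escaping global centre INSIDE the exceptional divisor, READ ON
# THE OTHER CHARTS — sheaf level (brick S3-N1 «atlas of an escaping global centre», part E6, case `j ∈ S'`; cell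
# `res-dim4-pi`, typ-2 g5)

[OURS · counted 0] (D-0157 DOOR 2; DR-157-C; desk WORD #115 (a) (S3-N1); typ-3 g4 `S3c-V3-DESIGN.md` addendum (b); frame
`PIDim4.TerminationImpliesOrderReduction`, S3 (c)). Setting of typ-2 g4's C1 (`…ChartClosureInside`): `π : W → 𝔸⁵_K` ANY
blowing up along `V(z, x_S)`, `j ∈ S ∩ S'`, `Θⱼ` the re-centring of the `x_j`-chart, `φⱼ = Spec Θⱼ ≫ chartImm_j`, `H` the lift
of A2 for `S'`, `S″ = S' ∖ {j}`, `Z' = St_π(𝒥″) + 𝓘_{E₁}` (the regular snc centre `E₁ ∩ T″`), and the global centre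
`Zc = 𝓘(closure φⱼ(V(z, x_{S'})))` — an irreducible COMPONENT of `V(Z')` (C1 `closureImage_mem_boundaryPieces`). NEW: a
centre variable `l ∈ S ∖ S'` and E5's cleaned shear `Θ = Ξ.trans θ` of the `x_l`-chart, `φ_l = Spec Θ ≫ chartImm_l`.
PROVED here (no `sorry`, no new axiom):

* `comap_shear_chart_strictTransformIdeal_graph_erase_sup` — `φ_l^* Z' = 𝓘Λ_{insert l S″}`;
* `inter_eq_inter_of_mem_componentsIn` — topology: a component of a closed `Z` meeting an open `U` with `Z ∩ U` irreducible
  has the same trace on `U` as `Z`;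
* `support_globalCentre_inter_range_nonempty` — `V(Zc) ∩ W[⊤, x_l] ≠ ∅` (the generic point of the chart-`j` image has
  `x_l + b_l ∉ 𝔭`, so it lies in the `x_l`-chart: E3's chart-ratio overlap lemma);
* **`comap_shear_chart_globalCentre_of_mem`** — `φ_l^* Zc = 𝓘Λ_{insert l S″}`: ON THE `x_l`-CHART THE GLOBAL CENTRE OF A NEXT
  CENTRE INSIDE `E₁` READS `V(z, x_{S″}, x_l)` (`x_j = 0`, the equation of `E₁` on the `x_j`-chart, becomes `x_l = 0`);
* `image_shear_chart_subset_support_globalCentre_of_mem`, **`le_ordAlong_shear_reading_of_mem`** —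
  `p ≤ ord_{(x_{insert l S″})} F_l` for the reading `F_l = (τ g₀ + δ)^p + τ F'_l` (Q2 read back, as in E2).

HONEST SCOPE: `K` perfect of characteristic `p` where Q2 is used; cover and package for `j ∈ S'` are the sequel E7; older
boundary members (S3-N2), the walk over the added points and termination are not addressed. Nothing here is a statement
about resolution of singularities in dimension ≥ 4 / characteristic `p` (NOT proved anywhere in this programme). bears_on:
LADDER-RESOLUTION:D157-DOOR2 (res-dim4-pi). Supports stmt-ResolutionOfSingularities-16155 (helper, S3-N1 E6).
-/

-- every declaration of this summit lives under `Summit.ResolutionOfSingularities.ResolutionOfSingularities`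
-- (summit = problem), which the duplicate-namespace linter flags; house convention (cf. the Target file).
set_option linter.dupNamespace false

noncomputable section

open MvPolynomial Finset CategoryTheory AlgebraicGeometry Opposite TopologicalSpace
open AlgebraicGeometry.Scheme.IdealSheafData (ofIdealTop vanishingIdeal)

namespace Summit.ResolutionOfSingularities.ResolutionOfSingularities.Theorems.PIDim4

open Literature.AlgebraicGeometry.Resolution
open Literature.AlgebraicGeometry.Resolution.AffinePointBlowup (P A γ coord Wtop ξ)

namespace ChartDictionary

/-! ## §1 Topology: the trace of a component on an open set with irreducible trace -/

/-- **A component of a closed set `Z` that meets an open `U` on which `Z` is irreducible has the same trace on `U` as `Z`.**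
(`C ⊆ closure (C ∩ U) ⊆ closure (Z ∩ U)`, an irreducible subset of `Z` containing `C`, hence equal to it.) -/
theorem inter_eq_inter_of_mem_componentsIn {X : Type*} [TopologicalSpace X] {Z U C : Set X} (hZ : IsClosed Z)
    (hU : IsOpen U) (hirr : IsIrreducible (Z ∩ U)) (hC : C ∈ componentsIn Z) (hne : (C ∩ U).Nonempty) :
    C ∩ U = Z ∩ U := by
  obtain ⟨hCZ, hCirr, hmax⟩ := mem_componentsIn_iff.mp hC
  refine le_antisymm (Set.inter_subset_inter_left _ hCZ) ?_
  have h1 : C ⊆ closure (Z ∩ U) :=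
    (subset_closure_inter_of_isPreirreducible_of_isOpen hCirr.2 hU hne).trans
      (closure_mono (Set.inter_subset_inter_left _ hCZ))
  have h2 : closure (Z ∩ U) ⊆ C :=
    hmax _ (hZ.closure_subset_iff.mpr Set.inter_subset_left) hirr.closure h1
  exact fun x hx => ⟨h2 (subset_closure hx), hx.2⟩

section Scheme

variable {K : Type} [Field K] {p : ℕ} {S S' : Finset (Fin 4)} {j l : Fin 4} {b : Fin 4 → K}
  {Θⱼ : A 4 K ≃ₐ[K] A 4 K} {h : MvPolynomial (Fin 4) K} {F F₁ : MvPolynomial (Fin 4) K}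
  {Ξ θ : A 4 K ≃ₐ[K] A 4 K} {τ : MvPolynomial (Fin 4) K ≃ₐ[K] MvPolynomial (Fin 4) K} {g₀ δ : MvPolynomial (Fin 4) K}
  {W : Scheme.{0}} {π : W ⟶ P 4 K}

/-! ## §2 `Z' = St_π(𝒥″) + 𝓘_{E₁}` on the `x_l`-chart -/

/-- **`φ_l^* Z' = 𝓘Λ_{insert l S″}`**: on the re-centred `x_l`-chart the regular snc centre `E₁ ∩ T″` reads the coordinate
subspace `V(z, x_{S″}, x_l)` (E5's ring identity transported exactly as in C1). -/
theorem comap_shear_chart_strictTransformIdeal_graph_erase_sup (hj : j ∈ S) (hl : l ∈ S) (hlS' : l ∉ S') (hjl : j ≠ l)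
    (hΞ0 : Ξ (X 0) = X 0 + rename Fin.succ (τ g₀)) (hΞτ : ∀ i : Fin 4, Ξ (X i.succ) = rename Fin.succ (τ (X i)))
    (hτl : τ (X l) = X l) (hτj : τ (X j) = X j) (hτ1 : ∀ i ∈ S'.erase j ∩ S, τ (X i) = X i + C (b i) * X j)
    (hτ2 : ∀ k ∈ S'.erase j \ S, τ (X k) = X k + C (b k))
    {H : MvPolynomial (Fin 4) K} (hHl : coordBlowupSubst K (S : Set (Fin 4)) l H = X l * g₀)
    (hθ0 : θ (X 0) = X 0 + rename Fin.succ δ) (hθs : ∀ i : Fin 4, θ (X i.succ) = X i.succ)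
    (hδ : δ ∈ Ideal.span (X '' ((insert l (S'.erase j) : Finset (Fin 4)) : Set (Fin 4)) : Set (MvPolynomial (Fin 4) K)))
    (hπ : IsBlowup π (AffineCoordBlowup.𝓘Λ 4 K (insert 0 (Fin.succ '' (S : Set (Fin 4)))))) :
    (strictTransformIdeal π (AffineCoordBlowup.𝓘Λ 4 K (insert 0 (Fin.succ '' (S : Set (Fin 4)))))
        (Hironaka2005.idealSheafOf (Ideal.span (insert (X 0 - rename Fin.succ H)
          (((fun k : Fin 4 => (X k.succ - C (b k) : A 4 K)) '' ((S'.erase j \ S : Finset (Fin 4)) : Set (Fin 4))) ∪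
           ((fun i : Fin 4 => (X i.succ - C (b i) * X j.succ : A 4 K)) ''
             ((S'.erase j ∩ S : Finset (Fin 4)) : Set (Fin 4))))))) ⊔
      (AffineCoordBlowup.𝓘Λ 4 K (insert 0 (Fin.succ '' (S : Set (Fin 4))))).comap π).comap
      (Spec.map (CommRingCat.ofHom ((Ξ.trans θ : A 4 K ≃ₐ[K] A 4 K) : A 4 K →+* A 4 K)) ≫
        AffineCoordBlowup.chartImm hπ (succ_mem_centreVars hl)) =
      AffineCoordBlowup.𝓘Λ 4 K (insert 0 (Fin.succ '' ((insert l (S'.erase j) : Finset (Fin 4)) : Set (Fin 4)))) := by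
  have hlS'' : l ∉ S'.erase j := fun h => hlS' (Finset.mem_of_mem_erase h)
  have hΘl : ((Ξ.trans θ : A 4 K ≃ₐ[K] A 4 K) : A 4 K →+* A 4 K) (X l.succ) = X l.succ := by
    rw [RingHom.coe_coe, trans_clean_X_succ hΞτ hθs, hτl, rename_X]
  have hE : ofIdealTop (Ideal.span {coord 4 K l.succ}) = Hironaka2005.idealSheafOf (Ideal.span {(X l.succ : A 4 K)}) := by
    rw [Hironaka2005.idealSheafOf, Ideal.map_span, Set.image_singleton]
    rfl
  rw [(Scheme.IdealSheafData.map_gc _).l_sup, Scheme.IdealSheafData.comap_comp,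
    comap_chartImm_strictTransformIdeal_idealSheafOf hl hπ, Hironaka2005.comap_specMap_idealSheafOf,
    comap_exceptional_chart hl hΘl hπ, hE, ← Hironaka2005.idealSheafOf_sup,
    map_shear_clean_coordStrictTransformIdeal_graph_sup hj hlS'' hjl hΞ0 hΞτ hτl hτj hτ1 hτ2 hHl hθ0 hθs hδ,
    ← Cruxes.EquisingularLiftNat.Sections.ND.𝓘Λ_eq_idealSheafOf]

/-! ## §3 The global centre meets the `x_l`-chart -/

/-- **`V(Zc) ∩ W[⊤, x_l] ≠ ∅`** for `l ∈ S ∖ S'`: the image under `φⱼ` of the generic point of `V(z, x_{S'})` lies in `V(Zc)`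
and in the `x_l`-chart (its prime does not contain `Θⱼ(x_l) = x_l + b_l`, E5; chart-ratio overlap, E3). Any `S'`. -/
theorem support_globalCentre_inter_range_nonempty (hj : j ∈ S) (hl : l ∈ S) (hlS' : l ∉ S') (hjl : j ≠ l)
    (hsj : ∀ i : Fin 4, Θⱼ (X i.succ) = X i.succ + C (b i))
    (hπ : IsBlowup π (AffineCoordBlowup.𝓘Λ 4 K (insert 0 (Fin.succ '' (S : Set (Fin 4)))))) (Θ : A 4 K ≃ₐ[K] A 4 K) :
    haveI : IsIso (CommRingCat.ofHom (Θⱼ : A 4 K →+* A 4 K)) :=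
      (inferInstance : IsIso Θⱼ.toRingEquiv.toCommRingCatIso.hom)
    (((vanishingIdeal (closureImage
        (Spec.map (CommRingCat.ofHom (Θⱼ : A 4 K →+* A 4 K)) ≫ AffineCoordBlowup.chartImm hπ (succ_mem_centreVars hj))
        ((AffineCoordBlowup.𝓘Λ 4 K (insert 0 (Fin.succ '' (S' : Set (Fin 4))))).support : Set (P 4 K)))).support :
          Set W) ∩
      Set.range (Spec.map (CommRingCat.ofHom (Θ : A 4 K →+* A 4 K)) ≫
        AffineCoordBlowup.chartImm hπ (succ_mem_centreVars hl))).Nonempty := by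
  haveI : IsIso (CommRingCat.ofHom (Θⱼ : A 4 K →+* A 4 K)) :=
    (inferInstance : IsIso Θⱼ.toRingEquiv.toCommRingCatIso.hom)
  -- the generic point of `V(z, x_{S'})`
  let η : P 4 K := ⟨AffineCoordBlowup.IΛ 4 K (insert 0 (Fin.succ '' (S' : Set (Fin 4)))), AffineCoordBlowup.isPrime_IΛ 4 K _⟩
  have hη : η ∈ ((AffineCoordBlowup.𝓘Λ 4 K (insert 0 (Fin.succ '' (S' : Set (Fin 4))))).support : Set (P 4 K)) := by
    rw [AffineCoordBlowup.support_𝓘Λ]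
    exact IΛ_mem_CΛ S'
  set y := Spec.map (CommRingCat.ofHom (Θⱼ : A 4 K →+* A 4 K)) η with hy
  have hyl : (X l.succ : A 4 K) ∉ y.asIdeal := by
    intro hmem
    rw [hy, Spec.map_apply, PrimeSpectrum.comap_asIdeal, Ideal.mem_comap, CommRingCat.hom_ofHom, RingHom.coe_coe,
      hsj l] at hmem
    exact X_succ_add_C_not_mem_IΛ hlS' (b l) hmem
  refine ⟨AffineCoordBlowup.chartImm hπ (succ_mem_centreVars hj) y, ?_, ?_⟩
  · rw [Scheme.IdealSheafData.coe_support_vanishingIdeal, coe_closureImage]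
    exact subset_closure ⟨η, hη, by rw [hy]; rfl⟩
  · rw [range_specMap_comp_chartImm hπ (succ_mem_centreVars hl) Θ, ← Scheme.Hom.coe_opensRange]
    exact chartImm_apply_mem_opensRange_of_not_mem hπ (succ_mem_centreVars hj) (succ_mem_centreVars hl)
      (fun e => hjl (Fin.succ_inj.mp e).symm) hyl

/-! ## §4 The global centre on the `x_l`-chart -/

/-- **`φ_l⁻¹ V(Zc) = V(z, x_{S″}, x_l)`** (sets): `V(Zc)` is a component of `V(Z')` meeting the `x_l`-chart, on which `V(Z')`
is the irreducible `φ_l(V(z, x_{insert l S″}))`. -/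
theorem preimage_support_globalCentre_of_mem [Fact p.Prime] [CharP K p] (hj : j ∈ S) (hjS' : j ∈ S') (hbj : b j = 0)
    (h0j : Θⱼ (X 0) = X 0 + rename Fin.succ h) (hsj : ∀ i : Fin 4, Θⱼ (X i.succ) = X i.succ + C (b i))
    (hπ : IsBlowup π (AffineCoordBlowup.𝓘Λ 4 K (insert 0 (Fin.succ '' (S : Set (Fin 4))))))
    {H : MvPolynomial (Fin 4) K} (hH : coordBlowupSubst K (S : Set (Fin 4)) j H =
      X j * aeval (fun k => if k ∈ S' then (0 : MvPolynomial (Fin 4) K) else X k - C (b k)) h)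
    (hl : l ∈ S) (hlS' : l ∉ S')
    (hΞ0 : Ξ (X 0) = X 0 + rename Fin.succ (τ g₀)) (hΞτ : ∀ i : Fin 4, Ξ (X i.succ) = rename Fin.succ (τ (X i)))
    (hτl : τ (X l) = X l) (hτj : τ (X j) = X j) (hτ1 : ∀ i ∈ S'.erase j ∩ S, τ (X i) = X i + C (b i) * X j)
    (hτ2 : ∀ k ∈ S'.erase j \ S, τ (X k) = X k + C (b k))
    (hHl : coordBlowupSubst K (S : Set (Fin 4)) l H = X l * g₀)
    (hθ0 : θ (X 0) = X 0 + rename Fin.succ δ) (hθs : ∀ i : Fin 4, θ (X i.succ) = X i.succ)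
    (hδ : δ ∈ Ideal.span (X '' ((insert l (S'.erase j) : Finset (Fin 4)) : Set (Fin 4)) : Set (MvPolynomial (Fin 4) K))) :
    haveI : IsIso (CommRingCat.ofHom (Θⱼ : A 4 K →+* A 4 K)) :=
      (inferInstance : IsIso Θⱼ.toRingEquiv.toCommRingCatIso.hom)
    (Spec.map (CommRingCat.ofHom ((Ξ.trans θ : A 4 K ≃ₐ[K] A 4 K) : A 4 K →+* A 4 K)) ≫
        AffineCoordBlowup.chartImm hπ (succ_mem_centreVars hl)) ⁻¹'
      (((vanishingIdeal (closureImage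
        (Spec.map (CommRingCat.ofHom (Θⱼ : A 4 K →+* A 4 K)) ≫ AffineCoordBlowup.chartImm hπ (succ_mem_centreVars hj))
        ((AffineCoordBlowup.𝓘Λ 4 K (insert 0 (Fin.succ '' (S' : Set (Fin 4))))).support : Set (P 4 K)))).support :
          Set W)) =
      (AffineCoordBlowup.CΛ 4 K (insert 0 (Fin.succ '' ((insert l (S'.erase j) : Finset (Fin 4)) : Set (Fin 4)))) :
        Set (P 4 K)) := by
  haveI : IsIso (CommRingCat.ofHom (Θⱼ : A 4 K →+* A 4 K)) :=
    (inferInstance : IsIso Θⱼ.toRingEquiv.toCommRingCatIso.hom)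
  haveI : IsIso (CommRingCat.ofHom ((Ξ.trans θ : A 4 K ≃ₐ[K] A 4 K) : A 4 K →+* A 4 K)) :=
    (inferInstance : IsIso (Ξ.trans θ).toRingEquiv.toCommRingCatIso.hom)
  haveI : IsProper π := hπ.isProper
  haveI : IsLocallyNoetherian W := LocallyOfFiniteType.isLocallyNoetherian π
  haveI : CompactSpace W := QuasiCompact.compactSpace_of_compactSpace π
  haveI : IsNoetherian W := ⟨⟩
  have hjl : j ≠ l := fun e => hlS' (e ▸ hjS')
  set φ := Spec.map (CommRingCat.ofHom ((Ξ.trans θ : A 4 K ≃ₐ[K] A 4 K) : A 4 K →+* A 4 K)) ≫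
    AffineCoordBlowup.chartImm hπ (succ_mem_centreVars hl) with hφ
  set Z' := strictTransformIdeal π (AffineCoordBlowup.𝓘Λ 4 K (insert 0 (Fin.succ '' (S : Set (Fin 4)))))
        (Hironaka2005.idealSheafOf (Ideal.span (insert (X 0 - rename Fin.succ H)
          (((fun k : Fin 4 => (X k.succ - C (b k) : A 4 K)) '' ((S'.erase j \ S : Finset (Fin 4)) : Set (Fin 4))) ∪
           ((fun i : Fin 4 => (X i.succ - C (b i) * X j.succ : A 4 K)) ''
             ((S'.erase j ∩ S : Finset (Fin 4)) : Set (Fin 4))))))) ⊔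
        (AffineCoordBlowup.𝓘Λ 4 K (insert 0 (Fin.succ '' (S : Set (Fin 4))))).comap π with hZ'
  have hcomap : Z'.comap φ =
      AffineCoordBlowup.𝓘Λ 4 K (insert 0 (Fin.succ '' ((insert l (S'.erase j) : Finset (Fin 4)) : Set (Fin 4)))) :=
    comap_shear_chart_strictTransformIdeal_graph_erase_sup hj hl hlS' hjl hΞ0 hΞτ hτl hτj hτ1 hτ2 hHl hθ0 hθs hδ hπ
  -- `V(Z') ∩ range φ = φ(V(z, x_{insert l S″}))`, an irreducible set
  have htrace : (Z'.support : Set W) ∩ Set.range φ =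
      φ '' (AffineCoordBlowup.CΛ 4 K (insert 0 (Fin.succ '' ((insert l (S'.erase j) : Finset (Fin 4)) : Set (Fin 4)))) :
        Set (P 4 K)) := by
    ext w
    constructor
    · rintro ⟨hw, y, rfl⟩
      refine ⟨y, ?_, rfl⟩
      have h2 : y ∈ (Z'.comap φ).support := by rw [Scheme.IdealSheafData.support_comap]; exact hw
      rw [hcomap, AffineCoordBlowup.support_𝓘Λ] at h2
      exact h2
    · rintro ⟨y, hy, rfl⟩
      refine ⟨?_, y, rfl⟩
      have h2 : y ∈ (Z'.comap φ).support := by rw [hcomap, AffineCoordBlowup.support_𝓘Λ]; exact hy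
      rw [Scheme.IdealSheafData.support_comap] at h2
      exact h2
  have hirr : IsIrreducible ((Z'.support : Set W) ∩ Set.range φ) := by
    rw [htrace]
    exact (AffineCoordBlowup.isIrreducible_CΛ 4 K _).image φ φ.continuous.continuousOn
  -- `V(Zc)` is a component of `V(Z')` meeting the chart
  have hpiece := closureImage_mem_boundaryPieces hj hjS' hbj h0j hsj hπ hH
  rw [Kollar2007.mem_boundaryPieces_iff] at hpiece
  have hne := support_globalCentre_inter_range_nonempty (S' := S') hj hl hlS' hjl hsj hπ (Ξ.trans θ)
  rw [Scheme.IdealSheafData.coe_support_vanishingIdeal] at hne ⊢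
  have heq := inter_eq_inter_of_mem_componentsIn (Z'.support).isClosed φ.isOpenEmbedding.isOpen_range hirr hpiece hne
  -- pull back: `φ⁻¹(V(Zc)) = φ⁻¹(V(Zc) ∩ range φ) = φ⁻¹(V(Z') ∩ range φ) = V(φ^* Z')`
  have h1 : φ ⁻¹' ((closureImage (Spec.map (CommRingCat.ofHom (Θⱼ : A 4 K →+* A 4 K)) ≫
        AffineCoordBlowup.chartImm hπ (succ_mem_centreVars hj))
        ((AffineCoordBlowup.𝓘Λ 4 K (insert 0 (Fin.succ '' (S' : Set (Fin 4))))).support : Set (P 4 K)) : Set W)) =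
      φ ⁻¹' ((Z'.support : Set W) ∩ Set.range φ) := by
    rw [← heq, Set.preimage_inter, Set.preimage_range, Set.inter_univ]
  rw [h1, Set.preimage_inter, Set.preimage_range, Set.inter_univ]
  have h2 : φ ⁻¹' (Z'.support : Set W) = ((Z'.comap φ).support : Set (P 4 K)) := by
    rw [Scheme.IdealSheafData.support_comap]; rfl
  rw [h2, hcomap, AffineCoordBlowup.support_𝓘Λ]

/-- **`φ_l^* Zc = 𝓘Λ_{insert l S″}`: THE GLOBAL CENTRE OF A NEXT CENTRE INSIDE `E₁`, READ ON THE `x_l`-CHART** (`l ∈ S ∖ S'`),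
is the coordinate subspace `V(z, x_{S″}, x_l)`, `S″ = S' ∖ {j}`. -/
theorem comap_shear_chart_globalCentre_of_mem [Fact p.Prime] [CharP K p] (hj : j ∈ S) (hjS' : j ∈ S') (hbj : b j = 0)
    (h0j : Θⱼ (X 0) = X 0 + rename Fin.succ h) (hsj : ∀ i : Fin 4, Θⱼ (X i.succ) = X i.succ + C (b i))
    (hπ : IsBlowup π (AffineCoordBlowup.𝓘Λ 4 K (insert 0 (Fin.succ '' (S : Set (Fin 4))))))
    {H : MvPolynomial (Fin 4) K} (hH : coordBlowupSubst K (S : Set (Fin 4)) j H =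
      X j * aeval (fun k => if k ∈ S' then (0 : MvPolynomial (Fin 4) K) else X k - C (b k)) h)
    (hl : l ∈ S) (hlS' : l ∉ S')
    (hΞ0 : Ξ (X 0) = X 0 + rename Fin.succ (τ g₀)) (hΞτ : ∀ i : Fin 4, Ξ (X i.succ) = rename Fin.succ (τ (X i)))
    (hτl : τ (X l) = X l) (hτj : τ (X j) = X j) (hτ1 : ∀ i ∈ S'.erase j ∩ S, τ (X i) = X i + C (b i) * X j)
    (hτ2 : ∀ k ∈ S'.erase j \ S, τ (X k) = X k + C (b k))
    (hHl : coordBlowupSubst K (S : Set (Fin 4)) l H = X l * g₀)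
    (hθ0 : θ (X 0) = X 0 + rename Fin.succ δ) (hθs : ∀ i : Fin 4, θ (X i.succ) = X i.succ)
    (hδ : δ ∈ Ideal.span (X '' ((insert l (S'.erase j) : Finset (Fin 4)) : Set (Fin 4)) : Set (MvPolynomial (Fin 4) K))) :
    haveI : IsIso (CommRingCat.ofHom (Θⱼ : A 4 K →+* A 4 K)) :=
      (inferInstance : IsIso Θⱼ.toRingEquiv.toCommRingCatIso.hom)
    haveI : IsIso (CommRingCat.ofHom ((Ξ.trans θ : A 4 K ≃ₐ[K] A 4 K) : A 4 K →+* A 4 K)) :=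
      (inferInstance : IsIso (Ξ.trans θ).toRingEquiv.toCommRingCatIso.hom)
    (vanishingIdeal (closureImage
        (Spec.map (CommRingCat.ofHom (Θⱼ : A 4 K →+* A 4 K)) ≫ AffineCoordBlowup.chartImm hπ (succ_mem_centreVars hj))
        ((AffineCoordBlowup.𝓘Λ 4 K (insert 0 (Fin.succ '' (S' : Set (Fin 4))))).support : Set (P 4 K)))).comap
      (Spec.map (CommRingCat.ofHom ((Ξ.trans θ : A 4 K ≃ₐ[K] A 4 K) : A 4 K →+* A 4 K)) ≫
        AffineCoordBlowup.chartImm hπ (succ_mem_centreVars hl)) =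
      AffineCoordBlowup.𝓘Λ 4 K (insert 0 (Fin.succ '' ((insert l (S'.erase j) : Finset (Fin 4)) : Set (Fin 4)))) := by
  haveI : IsIso (CommRingCat.ofHom (Θⱼ : A 4 K →+* A 4 K)) :=
    (inferInstance : IsIso Θⱼ.toRingEquiv.toCommRingCatIso.hom)
  haveI : IsIso (CommRingCat.ofHom ((Ξ.trans θ : A 4 K ≃ₐ[K] A 4 K) : A 4 K →+* A 4 K)) :=
    (inferInstance : IsIso (Ξ.trans θ).toRingEquiv.toCommRingCatIso.hom)
  rw [comap_vanishingIdeal_of_isOpenImmersion, AffineCoordBlowup.𝓘Λ]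
  congr 1
  apply Closeds.ext
  rw [Closeds.coe_preimage, ← Scheme.IdealSheafData.coe_support_vanishingIdeal]
  exact preimage_support_globalCentre_of_mem hj hjS' hbj h0j hsj hπ hH hl hlS' hΞ0 hΞτ hτl hτj hτ1 hτ2 hHl hθ0 hθs hδ

/-! ## §5 Permissibility of the reading on the `x_l`-chart -/

/-- **`φ_l(V(z, x_{S″}, x_l)) ⊆ V(Zc)`.** -/
theorem image_shear_chart_subset_support_globalCentre_of_mem [Fact p.Prime] [CharP K p] (hj : j ∈ S) (hjS' : j ∈ S')
    (hbj : b j = 0) (h0j : Θⱼ (X 0) = X 0 + rename Fin.succ h) (hsj : ∀ i : Fin 4, Θⱼ (X i.succ) = X i.succ + C (b i))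
    (hπ : IsBlowup π (AffineCoordBlowup.𝓘Λ 4 K (insert 0 (Fin.succ '' (S : Set (Fin 4))))))
    {H : MvPolynomial (Fin 4) K} (hH : coordBlowupSubst K (S : Set (Fin 4)) j H =
      X j * aeval (fun k => if k ∈ S' then (0 : MvPolynomial (Fin 4) K) else X k - C (b k)) h)
    (hl : l ∈ S) (hlS' : l ∉ S')
    (hΞ0 : Ξ (X 0) = X 0 + rename Fin.succ (τ g₀)) (hΞτ : ∀ i : Fin 4, Ξ (X i.succ) = rename Fin.succ (τ (X i)))
    (hτl : τ (X l) = X l) (hτj : τ (X j) = X j) (hτ1 : ∀ i ∈ S'.erase j ∩ S, τ (X i) = X i + C (b i) * X j)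
    (hτ2 : ∀ k ∈ S'.erase j \ S, τ (X k) = X k + C (b k))
    (hHl : coordBlowupSubst K (S : Set (Fin 4)) l H = X l * g₀)
    (hθ0 : θ (X 0) = X 0 + rename Fin.succ δ) (hθs : ∀ i : Fin 4, θ (X i.succ) = X i.succ)
    (hδ : δ ∈ Ideal.span (X '' ((insert l (S'.erase j) : Finset (Fin 4)) : Set (Fin 4)) : Set (MvPolynomial (Fin 4) K))) :
    haveI : IsIso (CommRingCat.ofHom (Θⱼ : A 4 K →+* A 4 K)) :=
      (inferInstance : IsIso Θⱼ.toRingEquiv.toCommRingCatIso.hom)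
    (Spec.map (CommRingCat.ofHom ((Ξ.trans θ : A 4 K ≃ₐ[K] A 4 K) : A 4 K →+* A 4 K)) ≫
        AffineCoordBlowup.chartImm hπ (succ_mem_centreVars hl)) ''
        (AffineCoordBlowup.CΛ 4 K (insert 0 (Fin.succ '' ((insert l (S'.erase j) : Finset (Fin 4)) : Set (Fin 4)))) :
          Set (P 4 K)) ⊆
      ((vanishingIdeal (closureImage
        (Spec.map (CommRingCat.ofHom (Θⱼ : A 4 K →+* A 4 K)) ≫ AffineCoordBlowup.chartImm hπ (succ_mem_centreVars hj))
        ((AffineCoordBlowup.𝓘Λ 4 K (insert 0 (Fin.succ '' (S' : Set (Fin 4))))).support : Set (P 4 K)))).support :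
          Set W) := by
  rw [← preimage_support_globalCentre_of_mem hj hjS' hbj h0j hsj hπ hH hl hlS' hΞ0 hΞτ hτl hτj hτ1 hτ2 hHl hθ0 hθs hδ]
  exact Set.image_preimage_subset _ _

/-- **THE READING ON THE `x_l`-CHART IS PERMISSIBLE FOR `insert l S″`** (`j ∈ S'`): `p ≤ ord_{(x_{insert l S″})} F_l`,
`F_l = (τ g₀ + δ)^p + τ F'_l` the reading of the transform through the cleaned shear (Q2 read back, as in E2). -/
theorem le_ordAlong_shear_reading_of_mem [hp : Fact p.Prime] [CharP K p] [PerfectField K] (hj : j ∈ S) (hjS' : j ∈ S')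
    (hbj : b j = 0) (h0j : Θⱼ (X 0) = X 0 + rename Fin.succ h) (hsj : ∀ i : Fin 4, Θⱼ (X i.succ) = X i.succ + C (b i))
    (hπ : IsBlowup π (AffineCoordBlowup.𝓘Λ 4 K (insert 0 (Fin.succ '' (S : Set (Fin 4))))))
    (hperm : (p : ℕ∞) ≤ CentreBlowup.ordAlong S F)
    (hread : Θⱼ (coordBlowupSubst K (insert 0 (Fin.succ '' (S : Set (Fin 4)))) j.succ (hyp p F)) =
      X j.succ ^ p * hyp p F₁)
    (hperm' : (p : ℕ∞) ≤ CentreBlowup.ordAlong S' F₁)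
    {H : MvPolynomial (Fin 4) K} (hH : coordBlowupSubst K (S : Set (Fin 4)) j H =
      X j * aeval (fun k => if k ∈ S' then (0 : MvPolynomial (Fin 4) K) else X k - C (b k)) h)
    (hl : l ∈ S) (hlS' : l ∉ S')
    (hΞ0 : Ξ (X 0) = X 0 + rename Fin.succ (τ g₀)) (hΞτ : ∀ i : Fin 4, Ξ (X i.succ) = rename Fin.succ (τ (X i)))
    (hτl : τ (X l) = X l) (hτj : τ (X j) = X j) (hτ1 : ∀ i ∈ S'.erase j ∩ S, τ (X i) = X i + C (b i) * X j)
    (hτ2 : ∀ k ∈ S'.erase j \ S, τ (X k) = X k + C (b k))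
    (hHl : coordBlowupSubst K (S : Set (Fin 4)) l H = X l * g₀)
    (hθ0 : θ (X 0) = X 0 + rename Fin.succ δ) (hθs : ∀ i : Fin 4, θ (X i.succ) = X i.succ)
    (hδ : δ ∈ Ideal.span (X '' ((insert l (S'.erase j) : Finset (Fin 4)) : Set (Fin 4)) : Set (MvPolynomial (Fin 4) K))) :
    (p : ℕ∞) ≤ CentreBlowup.ordAlong (insert l (S'.erase j)) ((τ g₀ + δ) ^ p + τ (CentreBlowup.chartTransform p S l F)) := by
  haveI : IsIso (CommRingCat.ofHom (Θⱼ : A 4 K →+* A 4 K)) :=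
    (inferInstance : IsIso Θⱼ.toRingEquiv.toCommRingCatIso.hom)
  haveI : IsIso (CommRingCat.ofHom ((Ξ.trans θ : A 4 K ≃ₐ[K] A 4 K) : A 4 K →+* A 4 K)) :=
    (inferInstance : IsIso (Ξ.trans θ).toRingEquiv.toCommRingCatIso.hom)
  set φ := Spec.map (CommRingCat.ofHom ((Ξ.trans θ : A 4 K ≃ₐ[K] A 4 K) : A 4 K →+* A 4 K)) ≫
    AffineCoordBlowup.chartImm hπ (succ_mem_centreVars hl) with hφ
  set M' := ((⟨hypSheaf p F, [], p⟩ : MarkedIdeal (P 4 K)).transform π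
    (AffineCoordBlowup.𝓘Λ 4 K (insert 0 (Fin.succ '' (S : Set (Fin 4)))))) with hM'
  refine le_ordAlong_of_CΛ_subset_support hp.out.ne_zero (insert l (S'.erase j)) _ [] fun y hy => ?_
  have h1 : φ y ∈ M'.support :=
    support_globalCentre_subset_support_transform hj hbj h0j hsj hπ hperm hread hperm'
      (image_shear_chart_subset_support_globalCentre_of_mem hj hjS' hbj h0j hsj hπ hH hl hlS' hΞ0 hΞτ hτl hτj hτ1 hτ2 hHl
        hθ0 hθs hδ ⟨y, hy, rfl⟩)
  change ((p : ℕ) : ℕ∞) ≤ idealOrder (hypSheaf p ((τ g₀ + δ) ^ p + τ (CentreBlowup.chartTransform p S l F))) y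
  rw [← comap_shear_chart_transform_ideal hl (trans_clean_X_zero hΞ0 hθ0 hθs) (trans_clean_X_succ hΞτ hθs) hπ hperm
    (⟨hypSheaf p F, [], p⟩ : MarkedIdeal (P 4 K)) rfl rfl, idealOrder_comap_of_isOpenImmersion]
  exact h1

end Scheme

end ChartDictionary

end Summit.ResolutionOfSingularities.ResolutionOfSingularities.Theorems.PIDim4

end
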